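import Summits.BirchSwinnertonDyer.BirchSwinnertonDyer.Theorems.EisensteinPrimesBSDpOnCellCOfNamedFactsV12
import Literature.NumberTheory.GaloisCohomology.TateGlobalEulerCharacteristicTotallyComplex
import Literature.NumberTheory.GaloisCohomology.RestrictedRamificationPoitouTateThreeLeTotallyComplex
import Literature.NumberTheory.IwasawaTheory.Greenberg2006.GlobalEulerPoincareCorankOfTateTC
import HarnessLib

/-!
# Crux 4 `BSDpOnCellC` (stmt-BirchSwinnertonDyer-19034), line «crystal»: the composition with FIVE hypotheses and `stub_publishedFacts` SHORTENED 27 → 25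
# (Greenberg 2006 Prop. 4.2 AND Prop. 4.1 are TREE THEOREMS: Prop. 4.2 = `Greenberg2006.LocalEulerPoincareCorank.prop42_localEulerPoincareCorank_holds`;
# Prop. 4.1 = `Greenberg2006.prop41_of_tate_of_poitouTate_three_le_of_isTotallyComplex` fed with Tate's global Euler–Poincaré characteristic AT
# TOTALLY COMPLEX FIELDS — PROVED today by cell bsd-eis' lane «TATE-EPC-TC» (`GaloisCohomology.forall_tateGlobalEulerPoincareCharacteristic_of_isTotallyComplex`,
# x1-p1-w3 g16 p703415 ∘ -w6 g10 p698862) — and Harari Thm. 17.13 (a) at totally complex fields (`forall_poitouTate_restricted_three_le_of_isTotallyComplex`,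
# p681302)) — tree theorem for a successor LEAD to adopt (cell `bsd-eis`, width seat `bsd-line-x2-p2` gen 14; `--supports stmt-BirchSwinnertonDyer-19034`;
# skeleton of record crystal v10 UNCHANGED, W-79)

`bsdpOnCellC_of_namedFactsV13 hPub25 hTwoVar hMember hWall hMCB : BSDpOnCellC` := `…OfNamedFactsV12.bsdpOnCellC_of_namedFactsV12` (this seat, p705663) applied to the
26-tuple rebuilt from the 25-conjunct `hPub25` (= v10's `stub_publishedFacts` text with the conjuncts `prop41_globalEulerPoincareCorank` and
`prop42_localEulerPoincareCorank` DELETED) and the tree proof of Prop. 4.1 in its slot. So a v13 skeleton = v10 minus `stub_acDescent` (derived, p704204) with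
those two conjuncts removed from `stub_publishedFacts` (25 PUB) and the one-line composition `BSDpOnCellC_of := …OfNamedFactsV13.bsdpOnCellC_of_namedFactsV13
stub_publishedFacts stub_twoVarRatDivPNew stub_memberInvariants stub_wallAlgebraic stub_mazurMC_cellB`. HONEST RESIDUAL of crux 4 on crystal after this file:
25 PUB(-chain) named facts + crux 3 + `stub_twoVarRatDivPNew` (UNPRINTED) + the Keller–Yin preprint-grade named statements of `stub_memberInvariants` /
`stub_wallAlgebraic`. CONDITIONAL-RESULT; nothing asserted; no summit statement, no BSD / MC / IMC is proved for any curve; 0 cells / labels / tiers move.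

References: as in `…OfNamedFactsV10/V11/V12`; [Greenberg2006] §4 A Props. 4.1, 4.2 (pp. 367–368); [MilneADT2006] I §5 Thm. 5.1, I §2 Thm. 2.8; [Harari2020]
Thm. 17.13 (a); [Tate1963DualityICM] Thm. 2.2.
-/



set_option autoImplicit false
set_option linter.dupNamespace false

noncomputable section


open scoped Classical MatrixGroups ModularForm

open CongruenceSubgroup WeierstrassCurve NumberField IsDedekindDomain Field PowerSeries
  Literature.NumberTheory.EllipticCurves Literature.NumberTheory.EllipticCurves.GreenbergSelmer
  Literature.NumberTheory.EllipticCurves.ModularForms Literature.NumberTheory.QuadraticFields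
  Literature.NumberTheory.EllipticCurves.Rank1Residual
  Literature.NumberTheory.EllipticCurves.Rank1Residual.Typed
  Literature.NumberTheory.EllipticCurves.KrizLi2019
  Literature.NumberTheory.EllipticCurves.GreenbergVatsal2000
  Literature.NumberTheory.EllipticCurves.Wuthrich2014
  Literature.NumberTheory.EllipticCurves.SteinWuthrich2013
  Literature.NumberTheory.EllipticCurves.Castella2018Exceptional
  Literature.NumberTheory.GaloisRepresentations Literature.NumberTheory.GaloisCohomology
  Literature.NumberTheory.Automorphic
  Summit.BirchSwinnertonDyer.Rank1Residual.X11b.AcSelmer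
  Summit.BirchSwinnertonDyer.Rank1Residual.X11b.Halves
  Summit.BirchSwinnertonDyer.Rank1Residual.X11b
  Summit.BirchSwinnertonDyer.Rank1Residual Summit.BirchSwinnertonDyer.Rank1Residual.X1
  Summit.BirchSwinnertonDyer.Rank1Residual.X2
open Literature.NumberTheory.EllipticCurves.KellerYin2024 (curveLocalLambda)



namespace Summit.BirchSwinnertonDyer.BirchSwinnertonDyer.Theorems.EisensteinPrimesBSDpOnCellCOfNamedFactsV13

open Literature.NumberTheory.EllipticCurves.CastellaGrossiLeeSkinner2022 Literature.NumberTheory.EllipticCurves.Castella2018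
  Literature.NumberTheory.IwasawaTheory Literature.NumberTheory.IwasawaTheory.Greenberg2016
  Literature.NumberTheory.IwasawaTheory.Greenberg2006
  Summit.BirchSwinnertonDyer.Rank1Residual.X1.KellerYinMuLambdaSplit
open Literature.NumberTheory.EllipticCurves.KellerYin2024
open Summit.BirchSwinnertonDyer.BirchSwinnertonDyer.Theorems.EisensteinPrimesBSDpOnCellCAccumDefs (TwoVarRatDivPNew)

open Summit.BirchSwinnertonDyer.BirchSwinnertonDyer.Theorems.EisensteinPrimesBSDpOnCellCOfNamedFactsV12 (bsdpOnCellC_of_namedFactsV12)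

/-- **Crux 4 `BSDpOnCellC` BY NAME from FIVE stub texts with a 25-conjunct `stub_publishedFacts`** (v10's text minus
`prop41_globalEulerPoincareCorank` and `prop42_localEulerPoincareCorank`, both supplied by tree proofs: Greenberg 2006 Prop. 4.1 from Tate's global
Euler characteristic and Harari 17.13 (a) at totally complex fields; Prop. 4.2 from Tate's local Euler characteristic). CONDITIONAL; nothing asserted.
[claim: KellerYin2024, status: under-review] [cite: KellerYin2024, Thm. 5.1.3 = Thm. D, Lemma 5.1.1, Thm. 1.2.2 (arXiv:2402.12781v2) (shape only)]
[cite: CastellaGrossiLeeSkinner2022, Prop. 1.2.5, Thm. 1.2.2, Thm. 2.1.2, Thm. 2.2.2] [cite: Greenberg2016Selmer, Prop. 4.1.1] [cite: Greenberg2006, Props. 3.2, 4.1, 4.2]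
[cite: MilneADT2006, I §5 Thm. 5.1 and I §2 Thm. 2.8] [cite: Harari2020, Thm. 17.13 (a)] [cite: CastellaGrossiSkinner2025, Thm. 3.3.1] -/
theorem bsdpOnCellC_of_namedFactsV13
    (hPub :
    (((lambdaMu_multiplicative_of_gvPar ∧ thm16_charIdeal_dvd_multiplicative_of_reducible ∧
    thm61_splitMultiplicative ∧ thm61_nonsplitMultiplicative ∧
    (∀ (W : WeierstrassCurve ℚ) [W.IsElliptic] [W.IsGloballyMinimal] (p : ℕ) [Fact p.Prime],
      greenberg_stevens (W := W) (p := p)) ∧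
    exists_isNewformOf ∧
    hsieh2014_exists_anticyclotomicPAdicLFunction ∧
    (∀ (N : ℕ) [NeZero N] (W : WeierstrassCurve ℚ) (K : Type) [Field K] [NumberField K],
      gross_zagier N W K) ∧
    (∀ (N : ℕ) [NeZero N] (W : WeierstrassCurve ℚ) (K : Type) [Field K] [NumberField K],
      kolyvagin N W K) ∧
    rank_eq_analyticRank_of_analyticRank_le_one ∧ HoffsteinLuo1997_exists_twist_L_one_ne_zero ∧
    mazur_not_dvd_maninConstant_of_odd ∧ bsdRHS_eq_of_isIsogenous) ∧
    thm210_thm211_bdpDisplay_pNew) ∧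
    LiuZhangZhang2018.thm151_thm153_modularCurve_heegnerVector) ∧
    (prop125_characterGrSelmerDual_torsion_muZero_dim ∧ prop263_sur_of_crk ∧
      cor126_residualCharacter_globalLift ∧ cor126_residualCharacter_localSurjective ∧ prop411_selmer_isAlmostDivisible ∧
      prop32_cohomology_isCofinitelyGenerated ∧
      thm212_exists_isKatzLFunction ∧
      CastellaGrossiLeeSkinner2022.thm122_fe_omegaPartner_charGrDual_torsion_muZero_lambda_eq ∧
      CastellaGrossiLeeSkinner2022.thm122_charGrDual_torsion_muZero_firstUnit_lambda_eq ∧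
      Literature.NumberTheory.EllipticCurves.Castella2018.cas20_thm211_memberForms_sigmaFrames_congr))
    (hTwoVar :
    ∀ (W : WeierstrassCurve ℚ) [W.IsElliptic] [W.IsGloballyMinimal] (p : ℕ) [Fact p.Prime],
      CellC W p → TwoVarRatDivPNew W p)
    (hMember :
    Literature.NumberTheory.EllipticCurves.KellerYin2024.thm222_anacong_hidaMember_sigma_mu_OPEN ∧
      Literature.NumberTheory.EllipticCurves.KellerYin2024.thm222_anacong_hidaMember_sigma_lambda_OPEN)
    (hWall :
    (∀ (p : ℕ) [Fact p.Prime],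
      2 < p → ∀ (K : Type) [Field K] [NumberField K], IsImaginaryQuadratic K →
        SatisfiesHeegnerHypothesis p K → Odd (NumberField.discr K) → NumberField.discr K ≠ -3 →
      ∀ (ι : K →+* ℚ_[p]) (v vbar : HeightOneSpectrum (𝓞 K)),
        (∀ x : 𝓞 K, x ∈ v.asIdeal ↔ ‖ι (x : K)‖ < 1) →
        ((p : ℕ) : 𝓞 K) ∈ vbar.asIdeal → vbar ≠ v →
      ∀ (κ : ZpExtension K p), κ.IsAnticyclotomic →
      ∀ (γ : absoluteGaloisGroup K) [Fact (κ.IsTopGenerator γ)],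
      ∀ (ι' : PadicAlgCl p ≃+* ℂ),
        (∀ (w : InfinitePlace K) (k : 𝓞 K), k ∈ v.asIdeal ↔ ‖ι'.symm (w.embedding (k : K))‖ < 1) →
      ∀ (θ : FramedGaloisRep ℚ (padicCoeffIntegers (∅ : Set (PadicAlgCl p))) 1),
        (∀ σ : absoluteGaloisGroup ℚ, θ σ ^ (p - 1) = 1) →
      ∀ (C : ℕ), SatisfiesHeegnerHypothesis C K →
        (∀ u : HeightOneSpectrum (𝓞 ℚ), ((C : ℤ) : 𝓞 ℚ) ∉ u.asIdeal → θ.IsUnramifiedAt u) →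
        (∀ u : HeightOneSpectrum (𝓞 ℚ), ((p : ℕ) : 𝓞 ℚ) ∈ u.asIdeal → θ.IsUnramifiedAt u) →
        (∀ g ∈ decomp vbar, ∀ m : charModule (∅ : Set (PadicAlgCl p)) (θ.restrictField K), p • m = 0 → g • m = m) →
      ∀ (θK : HeckeCharacter K), IsHeckeCharOf ι' (θ.restrictField K) θK →
      ∀ (D : DatumDualData κ γ (charModule (∅ : Set (PadicAlgCl p)) (θ.restrictField K))
          (Castella2018.AcSelmer.bdpData (charModule (∅ : Set (PadicAlgCl p)) (θ.restrictField K)) p vbar)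
          (∅ : Set (HeightOneSpectrum (𝓞 K)))),
      ∀ (Cbar : Finset (HeightOneSpectrum (𝓞 K))), (∀ u ∈ Cbar, ¬ θK.IsUnramifiedAt u) →
      ∀ (ΩK : ℂ) (Ωp : (unrIntegers p)ˣ) (L : UnrSeries p), ΩK ≠ 0 →
        IsKatzLFunction ι' v vbar Cbar κ γ θK ΩK ((Ωp : unrIntegers p) : ℂ_[p]) L →
      Module.Finite (IwasawaAlgebra p) D.X ∧ Module.IsTorsion (IwasawaAlgebra p) D.X ∧
        muInvariant p D.X = 0 ∧
        ∃ m : ℕ, FirstUnitCoeffAt L m ∧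
          lambdaInvariant p D.X =
            m + (if ∀ σ : absoluteGaloisGroup K, θ.restrictField K σ = 1 then 1 else 0)) ∧
      (∀ (W : WeierstrassCurve ℚ) [W.IsElliptic] [W.IsGloballyMinimal] (p : ℕ) [Fact p.Prime],
      2 < p → Mult W p → W.HasSplitMultiplicativeReductionAtPrime p →
      ∀ (K : Type) [Field K] [NumberField K],
        IsImaginaryQuadratic K → SatisfiesHeegnerHypothesis (W.conductorNorm ℤ) K →
        Odd (NumberField.discr K) → NumberField.discr K ≠ -3 →
        ∀ (κ : ZpExtension K p), κ.IsAnticyclotomic →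
          ∀ (γ : Field.absoluteGaloisGroup K) [Fact (κ.IsTopGenerator γ)]
            (𝔭 : HeightOneSpectrum (𝓞 K)), ((p : ℕ) : 𝓞 K) ∈ 𝔭.asIdeal →
            𝔭.asIdeal.ramificationIdx (𝓞 ℚ) = 1 → 𝔭.asIdeal.inertiaDeg (𝓞 ℚ) = 1 →
            ∀ (𝔭bar : HeightOneSpectrum (𝓞 K)), ((p : ℕ) : 𝓞 K) ∈ 𝔭bar.asIdeal → 𝔭bar ≠ 𝔭 →
              ((Ideal.span {(p : ℤ)}).primesOver (𝓞 K)).ncard = 2 →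
            ∀ (ι' : PadicAlgCl p ≃+* ℂ),
              (∀ (w : InfinitePlace K) (k : 𝓞 K), k ∈ 𝔭.asIdeal ↔ ‖ι'.symm (w.embedding (k : K))‖ < 1) →
            ∀ (Φ : AddSubgroup (geomTorsion W (p : ℤ))), IsRationalLine W p Φ →
            ∀ (θsub θquot : FramedGaloisRep ℚ (padicCoeffIntegers (∅ : Set (PadicAlgCl p))) 1),
              IsTeichmullerLiftOn (∅ : Set (PadicAlgCl p)) (Φ.map (geomTorsion W (p : ℤ)).subtype) θsub →
              IsTeichmullerLiftOnQuot (∅ : Set (PadicAlgCl p)) (Φ.map (geomTorsion W (p : ℤ)).subtype)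
                (geomTorsion W (p : ℤ)) θquot →
            ∀ (φ ψ : FramedGaloisRep ℚ (padicCoeffIntegers (∅ : Set (PadicAlgCl p))) 1),
              (φ = θsub ∧ ψ = θquot ∨ φ = θquot ∧ ψ = θsub) →
              (∀ u : HeightOneSpectrum (𝓞 ℚ), ((p : ℕ) : 𝓞 ℚ) ∈ u.asIdeal → φ.IsUnramifiedAt u) →
            ∀ (θK : HeckeCharacter K), IsHeckeCharOf ι' (φ.restrictField K) θK →
            ∀ (Cbar : Finset (HeightOneSpectrum (𝓞 K))), (∀ u ∈ Cbar, ¬ θK.IsUnramifiedAt u) →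
            ∀ (ΩK' : ℂ) (Ωp' : (unrIntegers p)ˣ) (Lφ : UnrSeries p), ΩK' ≠ 0 →
              IsKatzLFunction ι' 𝔭 𝔭bar Cbar κ γ θK ΩK' ((Ωp' : unrIntegers p) : ℂ_[p]) Lφ →
            ∀ nφ : ℕ, FirstUnitCoeffAt Lφ nφ →
            ∀ (Dψ : DatumDualData κ γ (charModule (∅ : Set (PadicAlgCl p)) (ψ.restrictField K))
                (Castella2018.AcSelmer.bdpData (charModule (∅ : Set (PadicAlgCl p)) (ψ.restrictField K)) p 𝔭bar)
                (∅ : Set (HeightOneSpectrum (𝓞 K)))),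
              Module.Finite (IwasawaAlgebra p) Dψ.X ∧ Module.IsTorsion (IwasawaAlgebra p) Dψ.X ∧
                muInvariant p Dψ.X = 0 ∧ lambdaInvariant p Dψ.X = nφ))
    (hMCB :
    Summit.BirchSwinnertonDyer.BirchSwinnertonDyer.Theses.EisensteinPrimes.MazurMCOnCellB)
    : Summit.BirchSwinnertonDyer.BirchSwinnertonDyer.Theses.EisensteinPrimes.BSDpOnCellC := by
  obtain ⟨hA, h125, h263, hcg, hcl, h411, h32, h212, hfe, hch, hcas⟩ := hPub
  exact bsdpOnCellC_of_namedFactsV12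
    ⟨hA, h125, h263, hcg, hcl, h411,
      Literature.NumberTheory.IwasawaTheory.Greenberg2006.prop41_of_tate_of_poitouTate_three_le_of_isTotallyComplex
        Literature.NumberTheory.GaloisCohomology.forall_tateGlobalEulerPoincareCharacteristic_of_isTotallyComplex
        Literature.NumberTheory.GaloisCohomology.forall_poitouTate_restricted_three_le_of_isTotallyComplex,
      h32, h212, hfe, hch, hcas⟩
    hTwoVar hMember hWall hMCB

end Summit.BirchSwinnertonDyer.BirchSwinnertonDyer.Theorems.EisensteinPrimesBSDpOnCellCOfNamedFactsV13

end
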